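import Summits.AnomalousDissipation.AnomalousDissipation.Theorems.SawtoothPulseCascadeK1LocalisedCascadePhaseOneHTail
import Summits.AnomalousDissipation.AnomalousDissipation.Theorems.SawtoothPulseCascadeK1LocalisedCascadePhaseOneJunkSplit
import Summits.AnomalousDissipation.AnomalousDissipation.Theorems.SawtoothPulseCascadeK1LocalisedCascadePhaseOneHFibres020
import Summits.AnomalousDissipation.AnomalousDissipation.Theorems.SawtoothPulseCascadeK1LocalisedCascadePhaseOneHFibres063
import Summits.AnomalousDissipation.AnomalousDissipation.Theorems.SawtoothPulseCascadeK1LocalisedCascadePhaseOneHFibres106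
import Summits.AnomalousDissipation.AnomalousDissipation.Theorems.SawtoothPulseCascadeK1LocalisedCascadePhaseOneHFibres149
import Summits.AnomalousDissipation.AnomalousDissipation.Theorems.SawtoothPulseCascadeK1LocalisedCascadePhaseOneHFibres192
import Summits.AnomalousDissipation.AnomalousDissipation.Theorems.SawtoothPulseCascadeK1LocalisedCascadePhaseOneHFibres235
import Summits.AnomalousDissipation.AnomalousDissipation.Theorems.SawtoothPulseCascadeK1LocalisedCascadePhaseOneHFibres278
import Summits.AnomalousDissipation.AnomalousDissipation.Theorems.SawtoothPulseCascadeK1LocalisedCascadePhaseOneHFibres301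
import Summits.AnomalousDissipation.AnomalousDissipation.Theorems.SawtoothPulseCascadeK1LocalisedCascadePhaseOneHFibres344
import Summits.AnomalousDissipation.AnomalousDissipation.Theorems.SawtoothPulseCascadeK1LocalisedCascadePhaseOneHFibres387

/-!
# K1loc explicit start, phase 1: the horizontal junk `j_H(K′ = 120) ≤ 29/10⁴`

Assembly of the phase-1 horizontal junk bound consumed by the start box
`K1Start.phaseTwo_start20_le_of_junk` (hypothesis `hJH` with `K' = 120`):
`j_H := Σ'_k [20 ≤ |k₀| ∧ |k₁| < 120] ‖𝓕b₁(k)‖² ≤ 29/10⁴`.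

* §1 bookkeeping: fibre sums as lattice `tsum`s (`Σ_{n∈N}Σ_{m∈W} c(n,m) = Σ'_k [k₀∈N ∧ k₁∈W] c k`,
  `Σ_{n∈N} Σ'_q [q∉S] c(n,q) ≤ Σ'_k [k₁∉S] c k`), `Icc`/`range` reindexing, and the ten-block regrouping
  of the generated fibre tables (`PhaseOneHFibres020 … 387`).
* §2 the bound: split `[20 ≤ |k₀| ∧ |k₁| < 120] ≤ [k₀ ∈ ±[20,400] ∧ |k₁| < 120] + [401 ≤ |k₀|]`; the finite part is
  `2·Σ_{n=20}^{400} X(n)` by the symmetry `X(−n) = X(n)` (`sum_window_sq_norm_hfibre_neg`), bounded by the blocks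
  (`2·ΣC_j = 0.0025013`) plus `10·` the `ℓ²` remainder (`phaseOne_vRemainder_le`, `Q_c = 100`: `≤ 176/10⁷`); the tail is
  H-invariant (`tsum_horizontalWeight_hstep`) and bounded by `phaseOne_hTail_le` (`≤ 181/10⁶`). Total `≤ 0.0028583 ≤ 29/10⁴`.

[cite: Grafakos2014, Prop. 3.2.7 (3) (Parseval/Plancherel on the torus)]
-/

set_option linter.style.longLine false

namespace Summit.AnomalousDissipation.AnomalousDissipation.Theorems.SawtoothPulseCascade.K1Start

open MeasureTheory Filter Topology UnitAddTorus Complex AddCircle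
open scoped Real
open Literature.Analysis Literature.Analysis.FunctionSpaces Literature.Analysis.FunctionSpaces.Torus Literature.Analysis.FluidPDE
open Literature.Analysis.FluidPDE.ShearStage
open Literature.Analysis.FluidPDE.SawtoothCascade Literature.Analysis.FluidPDE.SawtoothCascade.CascadeParams
open Summit.AnomalousDissipation.AnomalousDissipation.Theorems.SawtoothPulseCascade.K1Window

/-! ## §1 Bookkeeping -/

/-- **Window fibre sums as a lattice sum**: `Σ_{n∈N} Σ_{m∈W} c(n,m) = Σ'_k [k₀ ∈ N ∧ k₁ ∈ W] c k`. [folklore] -/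
theorem sum_fibre_window_eq_tsum (c : (Fin 2 → ℤ) → ℝ) (N W : Finset ℤ) :
    ∑ n ∈ N, ∑ m ∈ W, c ![n, m] = ∑' k : Fin 2 → ℤ, (if k 0 ∈ N ∧ k 1 ∈ W then c k else 0) := by
  classical
  have h1 : ∀ n, ∑ m ∈ W, c ![n, m] = ∑' k : Fin 2 → ℤ, (if k 0 = n ∧ k 1 ∈ W then c k else 0) :=
    fun n => (tsum_hslab_window_eq_sum c n W).symm
  have hsn : ∀ n, Summable fun k : Fin 2 → ℤ => (if k 0 = n ∧ k 1 ∈ W then c k else 0) := fun n =>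
    summable_of_ne_finset_zero (s := W.image fun m => ![n, m]) fun k hk => by
      split_ifs with h
      · exact absurd (Finset.mem_image.2 ⟨k 1, h.2, by ext i; fin_cases i <;> simp [h.1]⟩) hk
      · rfl
  simp_rw [h1]
  rw [← Summable.tsum_finsetSum fun n _ => hsn n]
  refine tsum_congr fun k => ?_
  by_cases hk : k 0 ∈ N
  · rw [Finset.sum_eq_single (k 0) (fun n _ hn => if_neg fun h : k 0 = n ∧ k 1 ∈ W => hn h.1.symm)
      fun h => absurd hk h]
    simp [hk]
  · rw [Finset.sum_eq_zero fun n hn => if_neg fun h : k 0 = n ∧ k 1 ∈ W => hk (h.1 ▸ hn),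
      if_neg fun h : k 0 ∈ N ∧ k 1 ∈ W => hk h.1]

/-- **Punctured-line fibre sums under the lattice sum**: for `0 ≤ c` summable,
`Σ_{n∈N} Σ'_q [q ∉ S] c(n,q) ≤ Σ'_k [k₁ ∉ S] c k`. [folklore] -/
theorem sum_fibre_lineCompl_le_tsum (c : (Fin 2 → ℤ) → ℝ) (hc : Summable c) (hc0 : ∀ k, 0 ≤ c k)
    (N S : Finset ℤ) :
    ∑ n ∈ N, ∑' q : ℤ, (if q ∈ S then 0 else c ![n, q]) ≤
      ∑' k : Fin 2 → ℤ, (if k 1 ∈ S then (0 : ℝ) else 1) * c k := by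
  classical
  simp_rw [tsum_line_compl_eq_tsum_hslab c _ S]
  have hsn : ∀ n, Summable fun k : Fin 2 → ℤ => (if k 0 = n ∧ k 1 ∉ S then c k else 0) := fun n =>
    Summable.of_nonneg_of_le (fun k => by split_ifs; exacts [hc0 k, le_rfl])
      (fun k => by split_ifs; exacts [le_rfl, hc0 k]) hc
  have hs2 : Summable fun k : Fin 2 → ℤ => (if k 1 ∈ S then (0 : ℝ) else 1) * c k :=
    Summable.of_nonneg_of_le (fun k => by split_ifs <;> simp [hc0 k])
      (fun k => by split_ifs <;> simp [hc0 k]) hc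
  rw [← Summable.tsum_finsetSum fun n _ => hsn n]
  refine Summable.tsum_le_tsum (fun k => ?_) (summable_sum fun n _ => hsn n) hs2
  by_cases hk : k 0 ∈ N
  · rw [Finset.sum_eq_single (k 0) (fun n _ hn => if_neg fun h : k 0 = n ∧ k 1 ∉ S => hn h.1.symm)
      fun h => absurd hk h]
    by_cases hS : k 1 ∈ S
    · rw [if_pos hS, zero_mul, if_neg fun h => h.2 hS]
    · rw [if_neg hS, one_mul]
      split_ifs
      · exact le_rfl
      · exact hc0 k
  · rw [Finset.sum_eq_zero fun n hn => if_neg fun h : k 0 = n ∧ k 1 ∉ S => hk (h.1 ▸ hn)]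
    split_ifs
    · simp
    · simp [hc0 k]

/-- `Σ_{n ∈ [lo, lo+L]} f(n) = Σ_{i<L+1} f(lo+i)`. [folklore] -/
theorem sum_Icc_eq_sum_range_shift (f : ℤ → ℝ) (lo : ℤ) (L : ℕ) :
    ∑ n ∈ Finset.Icc lo (lo + (L : ℕ)), f n = ∑ i ∈ Finset.range (L + 1), f (lo + (i : ℕ)) := by
  induction L with
  | zero => simp
  | succ L ih =>
    rw [Finset.sum_range_succ, ← ih]
    have e : Finset.Icc lo (lo + ((L + 1 : ℕ) : ℤ)) = insert (lo + ((L + 1 : ℕ) : ℤ)) (Finset.Icc lo (lo + (L : ℕ))) := by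
      ext n
      simp only [Finset.mem_insert, Finset.mem_Icc]
      push_cast
      omega
    have hni : lo + ((L + 1 : ℕ) : ℤ) ∉ Finset.Icc lo (lo + (L : ℕ)) := by
      rw [Finset.mem_Icc]; push_cast; omega
    rw [e, Finset.sum_insert hni, add_comm]

/-- `Σ_{i<m+L} Y(lo+i) = Σ_{i<m} Y(lo+i) + Σ_{i<L} Y(lo'+i)` for `lo' = lo + m`. [folklore] -/
theorem sum_range_split_shift (Y : ℤ → ℝ) (n m L : ℕ) (h : m + L = n) (lo lo' : ℤ) (h' : lo + m = lo') :
    ∑ i ∈ Finset.range n, Y (lo + (i : ℕ)) =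
      ∑ i ∈ Finset.range m, Y (lo + (i : ℕ)) + ∑ i ∈ Finset.range L, Y (lo' + (i : ℕ)) := by
  subst h h'
  induction L with
  | zero => simp
  | succ L ih =>
    rw [Nat.add_succ, Finset.sum_range_succ, ih, Finset.sum_range_succ, add_assoc]
    congr 3
    push_cast
    ring

/-- **Ten-block regrouping** of fibre tables on `20 ≤ n ≤ 400` (blocks of `43,43,43,43,43,43,23,43,43,14` fibres):
block bounds `ΣX ≤ C_j + 5Σρ` add up to `Σ_{i<381} X(20+i) ≤ ΣC_j + 5Σ_{i<381} ρ(20+i)`. [folklore] -/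
theorem blocks_total_381 {X ρ : ℤ → ℝ} {C₁ C₂ C₃ C₄ C₅ C₆ C₇ C₈ C₉ C₁₀ : ℝ}
    (h₁ : ∑ i ∈ Finset.range 43, X ((20 : ℤ) + (i : ℕ)) ≤ C₁ + 5 * ∑ i ∈ Finset.range 43, ρ ((20 : ℤ) + (i : ℕ)))
    (h₂ : ∑ i ∈ Finset.range 43, X ((63 : ℤ) + (i : ℕ)) ≤ C₂ + 5 * ∑ i ∈ Finset.range 43, ρ ((63 : ℤ) + (i : ℕ)))
    (h₃ : ∑ i ∈ Finset.range 43, X ((106 : ℤ) + (i : ℕ)) ≤ C₃ + 5 * ∑ i ∈ Finset.range 43, ρ ((106 : ℤ) + (i : ℕ)))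
    (h₄ : ∑ i ∈ Finset.range 43, X ((149 : ℤ) + (i : ℕ)) ≤ C₄ + 5 * ∑ i ∈ Finset.range 43, ρ ((149 : ℤ) + (i : ℕ)))
    (h₅ : ∑ i ∈ Finset.range 43, X ((192 : ℤ) + (i : ℕ)) ≤ C₅ + 5 * ∑ i ∈ Finset.range 43, ρ ((192 : ℤ) + (i : ℕ)))
    (h₆ : ∑ i ∈ Finset.range 43, X ((235 : ℤ) + (i : ℕ)) ≤ C₆ + 5 * ∑ i ∈ Finset.range 43, ρ ((235 : ℤ) + (i : ℕ)))
    (h₇ : ∑ i ∈ Finset.range 23, X ((278 : ℤ) + (i : ℕ)) ≤ C₇ + 5 * ∑ i ∈ Finset.range 23, ρ ((278 : ℤ) + (i : ℕ)))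
    (h₈ : ∑ i ∈ Finset.range 43, X ((301 : ℤ) + (i : ℕ)) ≤ C₈ + 5 * ∑ i ∈ Finset.range 43, ρ ((301 : ℤ) + (i : ℕ)))
    (h₉ : ∑ i ∈ Finset.range 43, X ((344 : ℤ) + (i : ℕ)) ≤ C₉ + 5 * ∑ i ∈ Finset.range 43, ρ ((344 : ℤ) + (i : ℕ)))
    (h₁₀ : ∑ i ∈ Finset.range 14, X ((387 : ℤ) + (i : ℕ)) ≤ C₁₀ + 5 * ∑ i ∈ Finset.range 14, ρ ((387 : ℤ) + (i : ℕ))) :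
    ∑ i ∈ Finset.range 381, X ((20 : ℤ) + (i : ℕ)) ≤
      (C₁ + C₂ + C₃ + C₄ + C₅ + C₆ + C₇ + C₈ + C₉ + C₁₀) + 5 * ∑ i ∈ Finset.range 381, ρ ((20 : ℤ) + (i : ℕ)) := by
  set Y : ℤ → ℝ := fun n => X n - 5 * ρ n with hY
  have hblk : ∀ (lo : ℤ) (L : ℕ) (C : ℝ),
      ∑ i ∈ Finset.range L, X (lo + (i : ℕ)) ≤ C + 5 * ∑ i ∈ Finset.range L, ρ (lo + (i : ℕ)) →
      ∑ i ∈ Finset.range L, Y (lo + (i : ℕ)) ≤ C := by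
    intro lo L C h
    simp only [hY]
    rw [Finset.sum_sub_distrib, ← Finset.mul_sum]
    linarith
  have hback : ∀ (lo : ℤ) (L : ℕ), ∑ i ∈ Finset.range L, X (lo + (i : ℕ)) =
      ∑ i ∈ Finset.range L, Y (lo + (i : ℕ)) + 5 * ∑ i ∈ Finset.range L, ρ (lo + (i : ℕ)) := by
    intro lo L
    simp only [hY]
    rw [Finset.sum_sub_distrib, ← Finset.mul_sum]
    ring
  have s₁ := sum_range_split_shift Y 381 43 338 (by norm_num) 20 63 (by norm_num)
  have s₂ := sum_range_split_shift Y 338 43 295 (by norm_num) 63 106 (by norm_num)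
  have s₃ := sum_range_split_shift Y 295 43 252 (by norm_num) 106 149 (by norm_num)
  have s₄ := sum_range_split_shift Y 252 43 209 (by norm_num) 149 192 (by norm_num)
  have s₅ := sum_range_split_shift Y 209 43 166 (by norm_num) 192 235 (by norm_num)
  have s₆ := sum_range_split_shift Y 166 43 123 (by norm_num) 235 278 (by norm_num)
  have s₇ := sum_range_split_shift Y 123 23 100 (by norm_num) 278 301 (by norm_num)
  have s₈ := sum_range_split_shift Y 100 43 57 (by norm_num) 301 344 (by norm_num)
  have s₉ := sum_range_split_shift Y 57 43 14 (by norm_num) 344 387 (by norm_num)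
  have b₁ := hblk _ _ _ h₁
  have b₂ := hblk _ _ _ h₂
  have b₃ := hblk _ _ _ h₃
  have b₄ := hblk _ _ _ h₄
  have b₅ := hblk _ _ _ h₅
  have b₆ := hblk _ _ _ h₆
  have b₇ := hblk _ _ _ h₇
  have b₈ := hblk _ _ _ h₈
  have b₉ := hblk _ _ _ h₉
  have b₁₀ := hblk _ _ _ h₁₀
  rw [hback 20 381]
  linarith

section Cascade

variable (P : CascadeParams) (hγ : P.γ = 8) (hN₀ : P.N₀ = 1) (hρN : P.ρN = 2) (hd : P.d = 2) (hδ₀ : 0 < P.δ₀)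
  (hδ₀' : P.δ₀ ≤ (2 : ℝ)⁻¹ ^ 30) (a b : ℕ → UnitAddTorus (Fin 2) → ℝ) (h0 : a 0 = datum)
  (hb : ∀ j, b j = a j ∘ shearMap 0 1 (amp ⟨P.U j, P.U_periodic j, P.contDiff_U (P.δ_pos hδ₀ (by rw [hd]; norm_num) j)⟩ P.γ))
  (hab : ∀ j, a (j + 1) = b j ∘ shearMap 1 0 (amp ⟨P.U j, P.U_periodic j, P.contDiff_U (P.δ_pos hδ₀ (by rw [hd]; norm_num) j)⟩ P.γ))

include hγ hN₀ hρN hd hδ₀' h0 hb hab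

/-! ## §2 The phase-1 horizontal junk -/

/-- **PHASE-1 HORIZONTAL JUNK** (`γ = 8`, `N₀ = 1`, `ρ_N = 2`, `d = 2`, `0 < δ₀ ≤ 2⁻³⁰`; `K′ = 120`):
`j_H = Σ'_k [20 ≤ |k₀| ∧ |k₁| < 120] ‖𝓕b₁(k)‖² ≤ 29/10⁴` — the hypothesis `hJH` of
`phaseTwo_start20_le_of_junk` with `K' = 120`, `jH = 29/10⁴`. [cite: Grafakos2014, Prop. 3.2.7 (3)] -/
theorem phaseOne_jH_le :
    ∑' k : Fin 2 → ℤ, (if ((20 : ℕ) : ℤ) ≤ |k 0| ∧ |k 1| < ((120 : ℕ) : ℤ) then (1 : ℝ) else 0) *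
      ‖mFourierCoeff (fun x => (b 1 x : ℂ)) k‖ ^ 2 ≤ 29 / 10 ^ 4 := by
  classical
  have hd' : 0 < P.d := by rw [hd]; norm_num
  set ψ₀ : ShearProfile := amp ⟨P.U 0, P.U_periodic 0, P.contDiff_U (P.δ_pos hδ₀ hd' 0)⟩ P.γ with hψ₀
  set ψ₁ : ShearProfile := amp ⟨P.U 1, P.U_periodic 1, P.contDiff_U (P.δ_pos hδ₀ hd' 1)⟩ P.γ with hψ₁
  have hb0 : b 0 = datum ∘ shearMap 0 1 ψ₀ := by rw [hb 0, h0]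
  have ha1 : a 1 = b 0 ∘ shearMap 1 0 ψ₀ := hab 0
  have hb1 : b 1 = a 1 ∘ shearMap 0 1 ψ₁ := hb 1
  have ha1c : Continuous (a 1) := by
    rw [ha1, hb0]
    exact (isSmooth_datum_comp_shearMap ψ₀).continuous.comp (continuous_shearMap 1 0 ψ₀)
  have hb1c : Continuous (b 1) := by rw [hb1]; exact ha1c.comp (continuous_shearMap 0 1 ψ₁)
  -- the two spectra
  set c : (Fin 2 → ℤ) → ℝ := fun k => ‖mFourierCoeff (fun x => (b 1 x : ℂ)) k‖ ^ 2 with hc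
  have hcs : Summable c := (hasSum_sq_mFourierCoeff_of_continuous (Complex.continuous_ofReal.comp hb1c)).summable
  have hc0 : ∀ k, 0 ≤ c k := fun k => sq_nonneg _
  set c' : (Fin 2 → ℤ) → ℝ := fun k => ‖mFourierCoeff (fun x => (a 1 x : ℂ)) k‖ ^ 2 with hc'
  have hcs' : Summable c' := (hasSum_sq_mFourierCoeff_of_continuous (Complex.continuous_ofReal.comp ha1c)).summable
  have hc0' : ∀ k, 0 ≤ c' k := fun k => sq_nonneg _
  -- fibre sums
  set Wm : Finset ℤ := Finset.Ioo (-(120 : ℤ)) 120 with hWm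
  obtain ⟨X, hX⟩ : ∃ X : ℤ → ℝ, ∀ n, X n = ∑ m ∈ Wm, c ![n, m] := ⟨_, fun _ => rfl⟩
  obtain ⟨ρ, hρ⟩ : ∃ ρ : ℤ → ℝ, ∀ n, ρ n =
      ∑' q : ℤ, (if 1 ≤ |q| ∧ |q| ≤ (100 : ℤ) then 0 else ‖mFourierCoeff (fun x => (a 1 x : ℂ)) ![n, q]‖ ^ 2) :=
    ⟨_, fun _ => rfl⟩
  -- (a) the ten generated blocks
  have hB := blocks_total_381 (X := X) (ρ := ρ)
    (by simp only [hX, hρ, hWm, hc]; exact hblock_range_120_20_62 P hγ hN₀ hρN hd hδ₀ hδ₀' a b h0 hb hab)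
    (by simp only [hX, hρ, hWm, hc]; exact hblock_range_120_63_105 P hγ hN₀ hρN hd hδ₀ hδ₀' a b h0 hb hab)
    (by simp only [hX, hρ, hWm, hc]; exact hblock_range_120_106_148 P hγ hN₀ hρN hd hδ₀ hδ₀' a b h0 hb hab)
    (by simp only [hX, hρ, hWm, hc]; exact hblock_range_120_149_191 P hγ hN₀ hρN hd hδ₀ hδ₀' a b h0 hb hab)
    (by simp only [hX, hρ, hWm, hc]; exact hblock_range_120_192_234 P hγ hN₀ hρN hd hδ₀ hδ₀' a b h0 hb hab)
    (by simp only [hX, hρ, hWm, hc]; exact hblock_range_120_235_277 P hγ hN₀ hρN hd hδ₀ hδ₀' a b h0 hb hab)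
    (by simp only [hX, hρ, hWm, hc]; exact hblock_range_120_278_300 P hγ hN₀ hρN hd hδ₀ hδ₀' a b h0 hb hab)
    (by simp only [hX, hρ, hWm, hc]; exact hblock_range_120_301_343 P hγ hN₀ hρN hd hδ₀ hδ₀' a b h0 hb hab)
    (by simp only [hX, hρ, hWm, hc]; exact hblock_range_120_344_386 P hγ hN₀ hρN hd hδ₀ hδ₀' a b h0 hb hab)
    (by simp only [hX, hρ, hWm, hc]; exact hblock_range_120_387_400 P hγ hN₀ hρN hd hδ₀ hδ₀' a b h0 hb hab)
  -- (b) the ℓ² remainder over the fibres `20 ≤ n ≤ 400`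
  set S : Finset ℤ := (Finset.Icc (-100 : ℤ) 100).filter (fun q => 1 ≤ |q| ∧ |q| ≤ (100 : ℤ)) with hS
  have hSiff : ∀ q : ℤ, q ∈ S ↔ (1 ≤ |q| ∧ |q| ≤ (100 : ℤ)) := by
    intro q
    rw [hS, Finset.mem_filter, Finset.mem_Icc, and_iff_right_iff_imp]
    intro h
    exact abs_le.1 h.2
  have hρS : ∀ n, ρ n = ∑' q : ℤ, (if q ∈ S then 0 else c' ![n, q]) := by
    intro n
    rw [hρ]
    refine tsum_congr fun q => ?_
    by_cases hq : 1 ≤ |q| ∧ |q| ≤ (100 : ℤ)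
    · rw [if_pos hq, if_pos ((hSiff q).2 hq)]
    · rw [if_neg hq, if_neg (fun h => hq ((hSiff q).1 h))]
  have hR : ∑ n ∈ Finset.Icc (20 : ℤ) 400, ρ n ≤ 176 / 10 ^ 7 := by
    simp_rw [hρS]
    refine (sum_fibre_lineCompl_le_tsum c' hcs' hc0' _ S).trans ?_
    have hv := phaseOne_vRemainder_le P hγ hN₀ hδ₀ hδ₀' hd' a b h0 (hb 0) (hab 0) 100 (by norm_num)
    have hnum : (Real.sqrt (2 * (2 * |((8 : ℤ) : ℝ)| * 0.31831) ^ 2 *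
        ((((100 + 1 : ℕ) : ℝ)) ^ 2 / (((100 + 1 : ℕ) : ℝ) ^ 2 - ((8 : ℤ) : ℝ) ^ 2)) ^ 2 /
          (3 * (((100 + 1 : ℕ) : ℝ) - 2) * (((100 + 1 : ℕ) : ℝ) - 1) * ((100 + 1 : ℕ) : ℝ))) + (2 : ℝ)⁻¹ ^ 25) ^ 2 ≤
        176 / 10 ^ 7 := by
      have hs : Real.sqrt (2 * (2 * |((8 : ℤ) : ℝ)| * 0.31831) ^ 2 *
          ((((100 + 1 : ℕ) : ℝ)) ^ 2 / (((100 + 1 : ℕ) : ℝ) ^ 2 - ((8 : ℤ) : ℝ) ^ 2)) ^ 2 /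
            (3 * (((100 + 1 : ℕ) : ℝ) - 2) * (((100 + 1 : ℕ) : ℝ) - 1) * ((100 + 1 : ℕ) : ℝ))) ≤ 0.0041849 := by
        rw [Real.sqrt_le_left (by norm_num)]; norm_num
      have h0 := Real.sqrt_nonneg (2 * (2 * |((8 : ℤ) : ℝ)| * 0.31831) ^ 2 *
          ((((100 + 1 : ℕ) : ℝ)) ^ 2 / (((100 + 1 : ℕ) : ℝ) ^ 2 - ((8 : ℤ) : ℝ) ^ 2)) ^ 2 /
            (3 * (((100 + 1 : ℕ) : ℝ) - 2) * (((100 + 1 : ℕ) : ℝ) - 1) * ((100 + 1 : ℕ) : ℝ)))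
      nlinarith
    have e : ∑' k : Fin 2 → ℤ, (if k 1 ∈ S then (0 : ℝ) else 1) * c' k =
        ∑' k : Fin 2 → ℤ, (if 1 ≤ |k 1| ∧ |k 1| ≤ ((100 : ℕ) : ℤ) then (0 : ℝ) else 1) * c' k := by
      refine tsum_congr fun k => ?_
      push_cast
      by_cases hq : 1 ≤ |k 1| ∧ |k 1| ≤ (100 : ℤ)
      · rw [if_pos hq, if_pos ((hSiff (k 1)).2 hq)]
      · rw [if_neg hq, if_neg (fun h => hq ((hSiff (k 1)).1 h))]
    rw [e]
    exact hv.trans hnum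
  -- (c) the finite part: symmetry and regrouping
  have hXsym : ∀ n, X (-n) = X n := by
    intro n
    rw [hX, hX, hWm]
    have h := sum_window_sq_norm_hfibre_neg (b 1) 120 n
    simpa using h
  set N : Finset ℤ := Finset.Icc (20 : ℤ) 400 ∪ Finset.Icc (-400 : ℤ) (-20) with hN
  have hNsum : ∑ n ∈ N, X n = 2 * ∑ n ∈ Finset.Icc (20 : ℤ) 400, X n := by
    have hdisj : Disjoint (Finset.Icc (20 : ℤ) 400) (Finset.Icc (-400 : ℤ) (-20)) := by
      rw [Finset.disjoint_left]; intro n h1 h2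
      rw [Finset.mem_Icc] at h1 h2; omega
    have himg : Finset.Icc (-400 : ℤ) (-20) = (Finset.Icc (20 : ℤ) 400).image (fun n => -n) := by
      ext n
      rw [Finset.mem_Icc, Finset.mem_image]
      constructor
      · intro h; exact ⟨-n, Finset.mem_Icc.2 ⟨by omega, by omega⟩, by omega⟩
      · rintro ⟨m, hm, rfl⟩; rw [Finset.mem_Icc] at hm; omega
    rw [hN, Finset.sum_union hdisj, himg, Finset.sum_image fun a _ b _ h => by simpa using h]
    simp_rw [hXsym]
    ring
  have hIcc : ∑ n ∈ Finset.Icc (20 : ℤ) 400, X n = ∑ i ∈ Finset.range 381, X ((20 : ℤ) + (i : ℕ)) := by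
    have e := sum_Icc_eq_sum_range_shift X 20 380
    norm_num at e
    exact e
  have hIccρ : ∑ n ∈ Finset.Icc (20 : ℤ) 400, ρ n = ∑ i ∈ Finset.range 381, ρ ((20 : ℤ) + (i : ℕ)) := by
    have e := sum_Icc_eq_sum_range_shift ρ 20 380
    norm_num at e
    exact e
  have hfin : ∑' k : Fin 2 → ℤ, (if k 0 ∈ N ∧ k 1 ∈ Wm then (1 : ℝ) else 0) * c k ≤
      2677271 / 10 ^ 9 := by
    have e1 : ∑' k : Fin 2 → ℤ, (if k 0 ∈ N ∧ k 1 ∈ Wm then (1 : ℝ) else 0) * c k =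
        ∑' k : Fin 2 → ℤ, (if k 0 ∈ N ∧ k 1 ∈ Wm then c k else 0) :=
      tsum_congr fun k => by split_ifs <;> simp
    have e2 : ∑ n ∈ N, X n = ∑' k : Fin 2 → ℤ, (if k 0 ∈ N ∧ k 1 ∈ Wm then c k else 0) := by
      simp_rw [hX]; exact sum_fibre_window_eq_tsum c N Wm
    rw [e1, ← e2, hNsum, hIcc]
    rw [hIccρ] at hR
    nlinarith [hB, hR]
  -- (d) the tail beyond `|k₀| > 400`: H-invariance and `phaseOne_hTail_le`
  have htail : ∑' k : Fin 2 → ℤ, (if (401 : ℤ) ≤ |k 0| then (1 : ℝ) else 0) * c k ≤ 181 / 10 ^ 6 := by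
    have e := tsum_horizontalWeight_hstep ha1c ψ₁ hb1 (w := fun m : ℤ => if (401 : ℤ) ≤ |m| then (1 : ℝ) else 0)
      (C := 1) (fun m => by split_ifs <;> simp)
    simp only [hc]
    exact e.le.trans (phaseOne_hTail_le P hγ hN₀ hδ₀ hδ₀' hd' a b h0 (hb 0) (hab 0))
  -- (e) split and add up
  have hsplit := tsum_indicator_split hcs hc0
    (w := fun k : Fin 2 → ℤ => if ((20 : ℕ) : ℤ) ≤ |k 0| ∧ |k 1| < ((120 : ℕ) : ℤ) then (1 : ℝ) else 0)
    (w₁ := fun k : Fin 2 → ℤ => if k 0 ∈ N ∧ k 1 ∈ Wm then (1 : ℝ) else 0)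
    (w₂ := fun k : Fin 2 → ℤ => if (401 : ℤ) ≤ |k 0| then (1 : ℝ) else 0)
    (fun k => by split_ifs <;> norm_num) (fun k => by split_ifs <;> norm_num)
    (fun k => by split_ifs <;> norm_num) (fun k => by split_ifs <;> norm_num)
    (fun k => by split_ifs <;> norm_num) (fun k => by split_ifs <;> norm_num)
    (fun k => by
      by_cases h4 : (401 : ℤ) ≤ |k 0|
      · rw [if_pos h4]
        split_ifs <;> norm_num
      · rw [if_neg h4, add_zero]
        by_cases h : ((20 : ℕ) : ℤ) ≤ |k 0| ∧ |k 1| < ((120 : ℕ) : ℤ)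
        · have hk0 := le_abs.1 h.1
          have hk0' := abs_lt.1 (not_le.1 h4)
          have hk1 := abs_lt.1 h.2
          push_cast at hk0 hk1
          have hmem : k 0 ∈ N ∧ k 1 ∈ Wm := by
            rw [hN, hWm, Finset.mem_union, Finset.mem_Icc, Finset.mem_Icc, Finset.mem_Ioo]
            exact ⟨by omega, by omega⟩
          rw [if_pos h, if_pos hmem]
        · rw [if_neg h]
          split_ifs <;> norm_num)
  have h3 := hsplit.trans (add_le_add hfin htail)
  refine h3.trans ?_
  norm_num

end Cascade

end Summit.AnomalousDissipation.AnomalousDissipation.Theorems.SawtoothPulseCascade.K1Start
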